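import Mathlib.Analysis.SpecialFunctions.Stirling
import Mathlib.Analysis.Complex.ExponentialBounds
import Literature.Barriers.ValiantsHypothesis.ShiftedPartialsTwoPowers
import Literature.Barriers.ValiantsHypothesis.PartialDerivativesDetPerm
import Literature.Barriers.ValiantsHypothesis.ShiftedPartialsCaseC1
import HarnessLib

/-!
# Shifted partial derivatives: Case C2 of Efremenko–Landsberg–Schenck–Weyman's Theorem 1.5
(the middle orders), from Macaulay's theorem

Support file for the barrier entry `ShiftedPartialDerivatives.lean` (`ShiftedPartialsCannotSeparate`,
ELSW Thm. 1.5). **Printed Case C2** (§4, "Case `2m ≤ k ≤ n-2m`"): "As long as `k < n-m`,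
`I^{ℓ^{n-m}perm_m,k}_{n-k} ⊂ ℓ^{n-m-k}·S^mW`, so `dim I^{ℓ^{n-m}perm_m,k}_{n-k+τ} ≤ binom(n²+m+τ-1, m+τ)`
(permesta). By Corollary 2.4 [Macaulay], it will be sufficient to show that
`dim I^{det_n,k}_{n-k} = binom(n,k)² ≥ dim S^mW = binom(n²+m-1, m)`. In the range `2m ≤ k ≤ n-2m`, the
quantity `binom(n,k)` is minimized at `k = 2m` and `k = n-2m`, so it is enough to show that
`binom(n,2m)² ≥ binom(n²+m-1, m)` [Stirling estimates] which holds for all sufficiently large `m` when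
`n > m²`."

What is here (everything except Macaulay's theorem, which enters as an explicit hypothesis — the
statement of the tree's named fact `Literature.RingTheory.MvPolynomial.MacaulayGrowthBound`, ELSW
Cor. 2.4, spelled out so that this file does not depend on it):
* `shiftedPartialsRank_paddedPerPoly_lt_choose`: the permanent side in STRICT form,
  `rank((ℓ^{n-m}perm_m)_{(k,n-k)[τ]}) < binom(n²+m+τ-1, m+τ)` for `1 ≤ m < n`, `k + m ≤ n` (the printed
  chain `rank P ≤ dim S^{m+τ} ≤ rank det_n` is not strict as printed; strictness holds because the
  shifted partials of `P` only involve its `m²+1` variables beyond `ℓ^{n-m-k}`).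
* `choose_le_shiftedPartialsRank_detPoly`: the determinant side from the Macaulay hypothesis and
  `dim I^{det_n,k}_{n-k} = binom(n,k)²` (the tree's `flatteningRank_detPoly`).
* `choose_sq_ge_choose`: `binom(n²+m-1, m) ≤ binom(n,k)²` with EXPLICIT constants `m ≥ 10`,
  `n > 2m²+2m`, in the range `3m ≤ 2k`, `k ≤ n-2m+1` — wider than the printed `2m ≤ k ≤ n-2m` on both
  sides, which is what the tree's assembly needs (Cases C1, C3/C4 are proved in narrower ranges than
  printed): monotonicity of `binom(n,·)` below `n/2`, `binom(n,j) ≥ (n+1-j)^j/j!`, Stirling's bound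
  `j! ≤ e√j (j/e)^j` (from Mathlib's `Stirling.stirlingSeq` monotonicity), `m! ≥ (m/e)^m`.
* `caseC2`: the case, conditional on the Macaulay hypothesis, any field.

## References

* [EfremenkoLandsbergSchenckWeyman2018] K. Efremenko, J. M. Landsberg, H. Schenck, J. Weyman,
  *The method of shifted partial derivatives cannot separate the permanent from the determinant*,
  Math. Comp. 87 (2018) 2037–2045, §2 (Cor. 2.4) and §4 (Case C2).
-/

noncomputable section

namespace Literature.Barriers.ValiantsHypothesis

open MvPolynomial Literature.Computability.AlgebraicComplexity

/-! ### The permanent side, strict form -/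

section PermSide

variable {K : Type*} [Field K]

/-- **Strict permanent-side bound (ELSW §4, (permesta), sharpened)**: for `1 ≤ m < n` and `k + m ≤ n`,
`rank((ℓ^{n-m}perm_m)_{(k,n-k)[τ]}) < dim S^{m+τ}W = binom(n² + m + τ - 1, m + τ)`: every monomial of a
shifted partial is `ℓ^{n-m-k}` times a monomial of degree `m + τ` having degree `≥ m` in the `m² + 1`
variables of the padded permanent, and `ℓ^{n-m-k} x₀₁^{m+τ}` is not of that kind. The printed bound is
the non-strict `≤ binom(n²+m+τ-1, m+τ)`. [cite: EfremenkoLandsbergSchenckWeyman2018, §4 (permesta)] -/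
theorem shiftedPartialsRank_paddedPerPoly_lt_choose {m n : ℕ} [NeZero n] (hm : 1 ≤ m) (hmn : m < n)
    (k τ : ℕ) (hk : k + m ≤ n) :
    shiftedPartialsRank K k τ (paddedPerPoly K m n) < (n ^ 2 + (m + τ) - 1).choose (m + τ) := by
  classical
  set a : Fin n × Fin n := ((0 : Fin n), (0 : Fin n)) with ha
  set Z : Finset (Fin n × Fin n) := Finset.univ.filter fun v : Fin n × Fin n =>
    v = (0, 0) ∨ (n - m ≤ v.1.val ∧ n - m ≤ v.2.val) with hZ
  set B := ((Finset.univ : Finset (Fin n × Fin n)).finsuppAntidiag ((m + τ) + (n - m - k))).filter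
    (fun μ : (Fin n × Fin n) →₀ ℕ => n - m - k ≤ μ a) with hB
  set T := B.filter (fun μ : (Fin n × Fin n) →₀ ℕ => n - k ≤ ∑ v ∈ Z, μ v) with hT
  -- rank ≤ #T
  have h1 : shiftedPartialsRank K k τ (paddedPerPoly K m n) ≤ T.card := by
    haveI := finite_restrictSupport (K := K) T
    rw [← finrank_restrictSupport (K := K) T]
    unfold shiftedPartialsRank
    apply Submodule.finrank_mono
    rw [Submodule.span_le]
    rintro _ ⟨l, β, hl, hβ, rfl⟩
    rw [SetLike.mem_coe, mem_restrictSupport_iff]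
    intro μ hμ
    have hP : (paddedPerPoly K m n).IsHomogeneous n := paddedPerPoly_isHomogeneous hmn.le
    have hw : (iterPDeriv l (paddedPerPoly K m n)).IsHomogeneous (n - k) :=
      hl ▸ isHomogeneous_iterPDeriv hP l
    have hvars : (iterPDeriv l (paddedPerPoly K m n)).vars ⊆ Z :=
      (vars_iterPDeriv_subset l _).trans vars_paddedPerPoly_subset
    have hord : iterPDeriv l (paddedPerPoly K m n) ∈
        restrictSupport K {β : (Fin n × Fin n) →₀ ℕ | n - m - k ≤ β a} := by
      have h0 : paddedPerPoly K m n ∈ restrictSupport K {β : (Fin n × Fin n) →₀ ℕ | n - m ≤ β a} := by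
        have := monomial_mul_mem_orderFiltration (K := K) a (Finsupp.single a (n - m))
          (rename (fun ij : BlockIdx m n × BlockIdx m n => ((ij.1 : Fin n), (ij.2 : Fin n)))
            (perPoly (BlockIdx m n) K))
        rwa [Finsupp.single_eq_same, ← X_pow_eq_monomial] at this
      have := iterPDeriv_mem_orderFiltration h0 l
      rwa [hl, Nat.sub_sub, show m + k = k + m from Nat.add_comm m k, ← Nat.sub_sub, show n - k - m = n - m - k by omega] at this
    obtain ⟨hdeg, hsum⟩ := support_monomial_mul_subset Z hw hvars β (Finset.mem_coe.1 hμ)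
    obtain ⟨hle, hγ⟩ := le_and_mem_support_of_mem_support_monomial_mul β _ (Finset.mem_coe.1 hμ)
    have hordγ : n - m - k ≤ (μ - β) a := (mem_orderFiltration_iff.1 hord) _ (mem_support_iff.1 hγ)
    rw [Finset.mem_coe, hT, Finset.mem_filter, hB, Finset.mem_filter,
      ← degree_eq_iff_mem_finsuppAntidiag]
    refine ⟨⟨?_, ?_⟩, hsum⟩
    · rw [hdeg, hβ]; omega
    · rw [Finsupp.tsub_apply] at hordγ; omega
  -- #T < #B = binom
  have h2 : T.card < B.card := by
    apply Finset.card_lt_card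
    rw [Finset.ssubset_iff_of_subset (Finset.filter_subset _ _)]
    set w : Fin n × Fin n := ((0 : Fin n), (1 : Fin n)) with hw
    have hwa : w ≠ a := by
      rw [hw, ha]
      intro h
      have := congrArg (fun v : Fin n × Fin n => v.2.val) h
      simp only [Fin.val_one', Fin.val_zero] at this
      rw [Nat.one_mod_eq_one.2 (by omega)] at this
      exact absurd this (by norm_num)
    have hwZ : w ∉ Z := by
      rw [hZ, Finset.mem_filter, not_and]
      intro _
      rintro (h | ⟨h, -⟩)
      · exact hwa h
      · simp [hw] at h
        omega
    refine ⟨Finsupp.single a (n - m - k) + Finsupp.single w (m + τ), ?_, ?_⟩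
    · rw [hB, Finset.mem_filter, ← degree_eq_iff_mem_finsuppAntidiag, map_add,
        Finsupp.degree_single, Finsupp.degree_single, Finsupp.add_apply, Finsupp.single_eq_same,
        Finsupp.single_apply, if_neg hwa]
      omega
    · rw [Finset.mem_filter, not_and]
      intro _
      have : ∑ v ∈ Z, (Finsupp.single a (n - m - k) + Finsupp.single w (m + τ) :
          (Fin n × Fin n) →₀ ℕ) v = n - m - k := by
        have haZ : a ∈ Z := by rw [hZ, Finset.mem_filter]; exact ⟨Finset.mem_univ _, Or.inl rfl⟩
        rw [Finset.sum_eq_single_of_mem a haZ]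
        · rw [Finsupp.add_apply, Finsupp.single_eq_same, Finsupp.single_apply, if_neg hwa, add_zero]
        · intro v hv hva
          rw [Finsupp.add_apply, Finsupp.single_apply, if_neg (Ne.symm hva), Finsupp.single_apply,
            if_neg (fun h : w = v => hwZ (h ▸ hv)), add_zero]
      rw [this]
      omega
  have h3 : B.card = (n ^ 2 + (m + τ) - 1).choose (m + τ) := by
    rw [hB, card_filter_le_apply, Fintype.card_prod, Fintype.card_fin, sq]
  omega

end PermSide

/-! ### The determinant side via Macaulay's bound -/

section DetSide

/-- **Determinant-side bound of Case C2 (ELSW §4)**, conditional on Macaulay's theorem in the form of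
ELSW Cor. 2.4 (the hypothesis `hMac` is literally the statement of the tree's named fact
`Literature.RingTheory.MvPolynomial.MacaulayGrowthBound`): if
`dim I^{det_n,k}_{n-k} = binom(n,k)² ≥ dim S^mW = binom(n²+m-1, m)` (`1 ≤ m`, `k + m ≤ n`) then for every `τ`,
`rank((det_n)_{(k,n-k)[τ]}) ≥ dim S^{m+τ}W = binom(n²+m+τ-1, m+τ)`.
[cite: EfremenkoLandsbergSchenckWeyman2018, §4 (Case C2) and Cor. 2.4] -/
theorem choose_le_shiftedPartialsRank_detPoly
    (hMac : ∀ (K : Type) [Field K] (σ : Type) [Fintype σ] (d q τ : ℕ)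
      (V : Submodule K (MvPolynomial σ K)), q < d → (∀ v ∈ V, v.IsHomogeneous d) →
      (Fintype.card σ + (d - q) - 1).choose (d - q) ≤ Module.finrank K V →
      (Fintype.card σ + (d - q + τ) - 1).choose (d - q + τ) ≤
        Module.finrank K (Submodule.span K {p : MvPolynomial σ K | ∃ (β : σ →₀ ℕ)
          (v : MvPolynomial σ K), β.degree = τ ∧ v ∈ V ∧ p = monomial β 1 * v})) (K : Type) [Field K]
    {n k m : ℕ} (hm : 1 ≤ m) (hkm : k + m ≤ n)
    (hdim : (n ^ 2 + m - 1).choose m ≤ (n.choose k) ^ 2) (τ : ℕ) :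
    (n ^ 2 + (m + τ) - 1).choose (m + τ) ≤
      shiftedPartialsRank K k τ (Literature.Computability.AlgebraicComplexity.detPoly (Fin n) K) := by
  classical
  set D := Literature.Computability.AlgebraicComplexity.detPoly (Fin n) K with hD
  set V : Submodule K (MvPolynomial (Fin n × Fin n) K) := Submodule.span K (derivSet k D) with hV
  have hhom : ∀ v ∈ V, v.IsHomogeneous (n - k) := by
    have : V ≤ homogeneousSubmodule (Fin n × Fin n) K (n - k) := by
      rw [hV, Submodule.span_le]
      rintro _ ⟨l, hl, rfl⟩
      rw [SetLike.mem_coe, mem_homogeneousSubmodule]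
      have hDh : D.IsHomogeneous n := by
        simpa using (detPoly_isHomogeneous (n := Fin n) (k := K))
      exact hl ▸ isHomogeneous_iterPDeriv hDh l
    intro v hv
    exact (mem_homogeneousSubmodule _ _).1 (this hv)
  have hfin : Module.finrank K V = (n.choose k) ^ 2 := by
    rw [hV, ← shiftedPartialsRank_zero_eq, hD, flatteningRank_detPoly]
  have hmac := hMac K (Fin n × Fin n) (n - k) (n - k - m) τ V (by omega) hhom (by
    rw [hfin, Fintype.card_prod, Fintype.card_fin, ← sq, show n - k - (n - k - m) = m by omega]
    exact hdim)
  rw [Fintype.card_prod, Fintype.card_fin, ← sq, show n - k - (n - k - m) = m by omega] at hmac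
  refine hmac.trans ?_
  haveI := finite_span_shiftedPartials (K := K) k τ D
  apply Submodule.finrank_mono
  rw [Submodule.span_le]
  rintro _ ⟨β, v, hβ, hv, rfl⟩
  rw [SetLike.mem_coe]
  have : V ≤ (Submodule.span K (shiftedPartials k τ D)).comap
      (LinearMap.mulLeft K (monomial β (1 : K))) := by
    rw [hV, Submodule.span_le]
    rintro d ⟨l, hl, rfl⟩
    simp only [SetLike.mem_coe, Submodule.mem_comap, LinearMap.mulLeft_apply]
    exact Submodule.subset_span ⟨l, β, hl, hβ, rfl⟩
  exact this hv

end DetSide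

/-! ### The numerical inequality `binom(n²+m-1, m) ≤ binom(n, k)²` -/

section Numeric

open Real

/-- `binom(n, ·)` is increasing below `n/2`. [folklore] -/
theorem choose_le_choose_of_le_half {n a b : ℕ} (hab : a ≤ b) (hb : b ≤ n / 2) :
    n.choose a ≤ n.choose b := by
  induction b with
  | zero => simp [Nat.le_zero.1 hab]
  | succ b ih =>
    rcases Nat.eq_or_lt_of_le hab with rfl | hlt
    · exact le_rfl
    · exact (ih (Nat.lt_succ_iff.1 hlt) (by omega)).trans
        (Nat.choose_le_succ_of_lt_half_left (by omega))

/-- Stirling's upper bound `j! ≤ e √j (j/e)^j` for `j ≥ 1` (monotonicity of Mathlib's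
`Stirling.stirlingSeq`, whose value at `1` is `e/√2`). [folklore] -/
theorem factorial_le_stirling {j : ℕ} (hj : 1 ≤ j) :
    (j.factorial : ℝ) ≤ Real.exp 1 * √(j : ℝ) * ((j : ℝ) / Real.exp 1) ^ j := by
  obtain ⟨i, rfl⟩ : ∃ i, j = i + 1 := ⟨j - 1, by omega⟩
  have hanti := Stirling.stirlingSeq'_antitone (Nat.zero_le i)
  simp only [Function.comp_apply, Nat.succ_eq_add_one, zero_add, Stirling.stirlingSeq_one] at hanti
  rw [Stirling.stirlingSeq, div_le_iff₀ (by positivity)] at hanti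
  refine hanti.trans (le_of_eq ?_)
  have h2 : √(2 * ((i + 1 : ℕ) : ℝ)) = √2 * √((i + 1 : ℕ) : ℝ) := by
    rw [Real.sqrt_mul (by norm_num)]
  rw [h2]
  field_simp

/-- `(m/e)^m ≤ m!` (from `m^m/m! ≤ e^m`). [folklore] -/
theorem pow_div_exp_le_factorial (m : ℕ) : ((m : ℝ) / Real.exp 1) ^ m ≤ (m.factorial : ℝ) := by
  have h := Real.pow_div_factorial_le_exp (x := (m : ℝ)) (Nat.cast_nonneg m) m
  rw [div_le_iff₀ (by positivity)] at h
  rw [div_pow, div_le_iff₀ (by positivity), ← Real.exp_nat_mul, mul_one, mul_comm]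
  exact h

/-- `12 m ≤ (12/5)^m` for `m ≥ 10`. [folklore] -/
theorem twelve_mul_le_pow {m : ℕ} (hm : 10 ≤ m) : (12 : ℝ) * m ≤ (12 / 5 : ℝ) ^ m := by
  induction m, hm using Nat.le_induction with
  | base => norm_num
  | succ m hm ih =>
    have : (10 : ℝ) ≤ m := by exact_mod_cast hm
    rw [pow_succ]
    push_cast
    nlinarith

/-- The real-variable core of the Case C2 estimate: `b ≥ (3/2) n/m`, `c ≤ (11/4) n²/m`, `n ≥ 2m²`,
`m ≥ 10` imply `(12/5) c ≤ b³`. [folklore] -/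
theorem caseC2_core {m n b c : ℝ} (hm : 10 ≤ m) (hn : 2 * m ^ 2 ≤ n) (hb : 3 / 2 * n / m ≤ b)
    (hc : c ≤ 11 / 4 * n ^ 2 / m) : 12 / 5 * c ≤ b ^ 3 := by
  have hm0 : 0 < m := by linarith
  have hn0 : 0 < n := by nlinarith
  have h1 : (3 / 2 * n / m) ^ 3 ≤ b ^ 3 := pow_le_pow_left₀ (by positivity) hb 3
  refine le_trans ?_ h1
  refine (mul_le_mul_of_nonneg_left hc (by norm_num)).trans ?_
  rw [show (3 / 2 * n / m) ^ 3 = (27 / 8 * n ^ 3) / m ^ 3 by field_simp; ring,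
    show 12 / 5 * (11 / 4 * n ^ 2 / m) = (33 / 5 * n ^ 2) / m by ring,
    div_le_div_iff₀ hm0 (by positivity)]
  have key : 33 / 5 * m ^ 2 ≤ 27 / 8 * n := by nlinarith
  calc 33 / 5 * n ^ 2 * m ^ 3 = (n ^ 2 * m) * (33 / 5 * m ^ 2) := by ring
    _ ≤ (n ^ 2 * m) * (27 / 8 * n) := mul_le_mul_of_nonneg_left key (by positivity)
    _ = 27 / 8 * n ^ 3 * m := by ring

/-- `binom(n, j) ≥ (e (n+1-j)/j)^j / (e √j)` for `1 ≤ j ≤ n + 1` (`binom(n,j) j! ≥ (n+1-j)^j` and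
Stirling's upper bound for `j!`). [folklore] -/
theorem stirling_div_le_choose {n j : ℕ} (hj : 1 ≤ j) (hjn : j ≤ n + 1) :
    (Real.exp 1 * ((n : ℝ) + 1 - j) / j) ^ j / (Real.exp 1 * √(j : ℝ)) ≤ (n.choose j : ℝ) := by
  have hj0R : (0 : ℝ) < j := by exact_mod_cast hj
  have hdesc : ((n + 1 - j) ^ j : ℕ) ≤ j.factorial * n.choose j := by
    rw [← Nat.descFactorial_eq_factorial_mul_choose]; exact Nat.pow_sub_le_descFactorial n j
  have hdescR : ((n : ℝ) + 1 - j) ^ j ≤ (j.factorial : ℝ) * (n.choose j : ℝ) := by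
    have : (((n + 1 - j : ℕ) : ℝ)) = (n : ℝ) + 1 - j := by
      rw [Nat.cast_sub hjn]; push_cast; ring
    rw [← this]; exact_mod_cast hdesc
  have hstir := factorial_le_stirling hj
  rw [div_le_iff₀ (by positivity)]
  set E := Real.exp 1 with hE
  have hEJ : (E / j) ^ j * ((j : ℝ) / E) ^ j = 1 := by
    rw [← mul_pow, div_mul_div_comm, mul_comm E (j : ℝ), div_self (by positivity), one_pow]
  have h1 : (E * ((n : ℝ) + 1 - j) / j) ^ j = (E / j) ^ j * ((n : ℝ) + 1 - j) ^ j := by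
    rw [← mul_pow]; congr 1; ring
  calc (E * ((n : ℝ) + 1 - j) / j) ^ j = (E / j) ^ j * ((n : ℝ) + 1 - j) ^ j := h1
    _ ≤ (E / j) ^ j * ((j.factorial : ℝ) * (n.choose j : ℝ)) :=
        mul_le_mul_of_nonneg_left hdescR (by positivity)
    _ ≤ (E / j) ^ j * ((E * √(j : ℝ) * ((j : ℝ) / E) ^ j) * (n.choose j : ℝ)) :=
        mul_le_mul_of_nonneg_left (mul_le_mul_of_nonneg_right hstir (Nat.cast_nonneg _))
          (by positivity)
    _ = (n.choose j : ℝ) * (E * √(j : ℝ)) * ((E / j) ^ j * ((j : ℝ) / E) ^ j) := by ring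
    _ = (n.choose j : ℝ) * (E * √(j : ℝ)) := by rw [hEJ, mul_one]

/-- `binom(n²+m-1, m) ≤ (e (n²+m-1)/m)^m` (`binom(a,m) ≤ a^m/m!` and `m! ≥ (m/e)^m`). [folklore] -/
theorem choose_le_pow_exp_div {n m : ℕ} (hm : 1 ≤ m) (hn : 1 ≤ n) :
    ((n ^ 2 + m - 1).choose m : ℝ) ≤ (Real.exp 1 * ((n : ℝ) ^ 2 + m - 1) / m) ^ m := by
  have hm0 : (0 : ℝ) < m := by exact_mod_cast hm
  have hup : ((n ^ 2 + m - 1).choose m : ℝ) ≤ ((n : ℝ) ^ 2 + m - 1) ^ m / m.factorial := by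
    have := Nat.choose_le_pow_div (α := ℝ) m (n ^ 2 + m - 1)
    have hc : (((n ^ 2 + m - 1 : ℕ) : ℝ)) = (n : ℝ) ^ 2 + m - 1 := by
      rw [Nat.cast_sub (by omega)]; push_cast; ring
    rwa [hc] at this
  have hmfac := pow_div_exp_le_factorial m
  have hpos : (0 : ℝ) ≤ (n : ℝ) ^ 2 + m - 1 := by
    have : (1 : ℝ) ≤ n := by exact_mod_cast hn
    nlinarith
  calc ((n ^ 2 + m - 1).choose m : ℝ) ≤ ((n : ℝ) ^ 2 + m - 1) ^ m / m.factorial := hup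
    _ ≤ ((n : ℝ) ^ 2 + m - 1) ^ m / (((m : ℝ) / Real.exp 1) ^ m) :=
        div_le_div_of_nonneg_left (by positivity) (by positivity) hmfac
    _ = (Real.exp 1 * ((n : ℝ) ^ 2 + m - 1) / m) ^ m := by
        rw [div_pow, div_pow, div_div_eq_mul_div, mul_pow, mul_comm]

/-- **The numerical hypothesis of Case C2**: ELSW §4, "the quantity `binom(n,k)` is minimized at
`k = 2m` and `k = n-2m`, so it is enough to show that `binom(n,2m)² ≥ binom(n²+m-1, m)` ... which holds
for all sufficiently large `m` when `n > m²`" — proved with explicit constants and in the tree's wider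
range: `m ≥ 10`, `n > 2m²+2m`, `3m ≤ 2k`, `k ≤ n-2m+1` ⟹ `binom(n²+m-1, m) ≤ binom(n,k)²` (reduce to
`j₀ = ⌈3m/2⌉` by monotonicity, then `binom(n,j₀)² ≥ (e(n+1-j₀)/j₀)^{2j₀}/(e² j₀) ≥ (e(n²+m-1)/m)^m`).
[cite: EfremenkoLandsbergSchenckWeyman2018, §4 (Case C2, (esta))] -/
theorem choose_sq_ge_choose {m n k : ℕ} (hm : 10 ≤ m) (hn : 2 * m ^ 2 + 2 * m < n) (hk : 3 * m ≤ 2 * k)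
    (hkn : k + 2 * m ≤ n + 1) : (n ^ 2 + m - 1).choose m ≤ (n.choose k) ^ 2 := by
  obtain ⟨j₀, hj₀1, hj₀2⟩ : ∃ j₀, 3 * m ≤ 2 * j₀ ∧ 2 * j₀ ≤ 3 * m + 1 := ⟨(3 * m + 1) / 2, by omega⟩
  have hmn : 20 * m ≤ n := by nlinarith
  have hmono : n.choose j₀ ≤ n.choose k := by
    rcases le_or_gt k (n / 2) with h | h
    · exact choose_le_choose_of_le_half (by omega) h
    · rw [← Nat.choose_symm (show k ≤ n by omega)]
      exact choose_le_choose_of_le_half (by omega) (by omega)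
  suffices h : (n ^ 2 + m - 1).choose m ≤ (n.choose j₀) ^ 2 from
    h.trans (Nat.pow_le_pow_left hmono 2)
  have hj1 : 1 ≤ j₀ := by omega
  have hE1 := Real.exp_one_lt_d9
  have hE2 := Real.exp_one_gt_d9
  have he0 : 0 < Real.exp 1 := Real.exp_pos 1
  have hmR : (10 : ℝ) ≤ m := by exact_mod_cast hm
  have hnR : (20 : ℝ) * m ≤ n := by exact_mod_cast hmn
  have hnR2 : 2 * (m : ℝ) ^ 2 + 2 * m < n := by exact_mod_cast hn
  have hjR2 : 2 * (j₀ : ℝ) ≤ 3 * m + 1 := by exact_mod_cast hj₀2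
  have hj0R : (0 : ℝ) < j₀ := by exact_mod_cast hj1
  have hm0 : (0 : ℝ) < m := by linarith
  set b : ℝ := Real.exp 1 * ((n : ℝ) + 1 - j₀) / j₀ with hb
  set c : ℝ := Real.exp 1 * ((n : ℝ) ^ 2 + m - 1) / m with hc
  have hlow := stirling_div_le_choose hj1 (show j₀ ≤ n + 1 by omega)
  have hupc := choose_le_pow_exp_div (n := n) (show 1 ≤ m by omega) (by omega)
  rw [← hb] at hlow
  rw [← hc] at hupc
  -- the constants
  have hnj : (9 : ℝ) / 10 * n ≤ (n : ℝ) + 1 - j₀ := by linarith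
  have hb_ge : (3 : ℝ) / 2 * n / m ≤ b := by
    rw [hb, div_le_div_iff₀ hm0 hj0R]
    have h1 : (2.718 : ℝ) * (9 / 10 * n) ≤ Real.exp 1 * ((n : ℝ) + 1 - j₀) :=
      mul_le_mul (by linarith) hnj (by positivity) he0.le
    nlinarith
  have hb1 : (1 : ℝ) ≤ b := by
    refine le_trans ?_ hb_ge
    rw [le_div_iff₀ hm0]; linarith
  have hc_le : c ≤ (11 : ℝ) / 4 * n ^ 2 / m := by
    rw [hc]
    refine div_le_div_of_nonneg_right ?_ hm0.le
    have h1 : Real.exp 1 * ((n : ℝ) ^ 2 + m - 1) ≤ 2.7182818286 * ((n : ℝ) ^ 2 + m - 1) :=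
      mul_le_mul_of_nonneg_right hE1.le (by nlinarith)
    have h2 : 100 * ((m : ℝ) - 1) ≤ (n : ℝ) ^ 2 := by nlinarith
    nlinarith
  have hbc : (12 : ℝ) / 5 * c ≤ b ^ 3 := caseC2_core hmR (by linarith) hb_ge hc_le
  have hc0 : 0 ≤ c := by rw [hc]; apply div_nonneg _ hm0.le; apply mul_nonneg he0.le; nlinarith
  -- assemble
  have hsq : b ^ (2 * j₀) / (Real.exp 1 ^ 2 * j₀) ≤ (n.choose j₀ : ℝ) ^ 2 := by
    have := pow_le_pow_left₀ (by positivity) hlow 2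
    rw [div_pow, mul_pow, Real.sq_sqrt hj0R.le, ← pow_mul, mul_comm j₀ 2] at this
    exact this
  have h3m : b ^ (3 * m) ≤ b ^ (2 * j₀) := pow_le_pow_right₀ hb1 hj₀1
  have h52 : ((12 : ℝ) / 5 * c) ^ m ≤ b ^ (3 * m) :=
    calc ((12 : ℝ) / 5 * c) ^ m ≤ (b ^ 3) ^ m := pow_le_pow_left₀ (by positivity) hbc m
      _ = b ^ (3 * m) := (pow_mul b 3 m).symm
  have hej : Real.exp 1 ^ 2 * j₀ ≤ (12 / 5 : ℝ) ^ m := by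
    have h1 : Real.exp 1 ^ 2 ≤ 2.7182818286 ^ 2 := pow_le_pow_left₀ he0.le hE1.le 2
    have : Real.exp 1 ^ 2 * (j₀ : ℝ) ≤ 12 * m := by nlinarith
    exact this.trans (twelve_mul_le_pow hm)
  have hfinal : ((n ^ 2 + m - 1).choose m : ℝ) ≤ (n.choose j₀ : ℝ) ^ 2 := by
    calc ((n ^ 2 + m - 1).choose m : ℝ) ≤ c ^ m := hupc
      _ ≤ c ^ m * ((12 / 5 : ℝ) ^ m / (Real.exp 1 ^ 2 * j₀)) := by
          refine le_mul_of_one_le_right (by positivity) ?_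
          rw [one_le_div (by positivity)]; exact hej
      _ = ((12 : ℝ) / 5 * c) ^ m / (Real.exp 1 ^ 2 * j₀) := by rw [mul_pow]; ring
      _ ≤ b ^ (2 * j₀) / (Real.exp 1 ^ 2 * j₀) :=
          div_le_div_of_nonneg_right (h52.trans h3m) (by positivity)
      _ ≤ (n.choose j₀ : ℝ) ^ 2 := hsq
  rw [← Nat.cast_pow] at hfinal
  exact Nat.cast_le.1 hfinal

end Numeric

/-! ### Case C2 -/

/-- **Case C2 of ELSW Thm. 1.5, conditional on Macaulay's theorem** (hypothesis `hMac` = the statement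
of the named fact `Literature.RingTheory.MvPolynomial.MacaulayGrowthBound`, ELSW Cor. 2.4): over any
field, for `m ≥ 10`, `n > 2m² + 2m`, orders `k` with `3m ≤ 2k` and `k ≤ n - 2m + 1`, and every shift
`τ`: `rank((ℓ^{n-m}perm_m)_{(k,n-k)[τ]}) < rank((det_n)_{(k,n-k)[τ]})`, by `rank P < dim S^{m+τ} ≤ rank det_n`.
Printed range "`2m ≤ k ≤ n-2m`", `m > M` inexplicit; the tree's range is wider on both sides.
[cite: EfremenkoLandsbergSchenckWeyman2018, Thm. 1.5 and §4 (Case C2)] -/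
theorem caseC2
    (hMac : ∀ (K : Type) [Field K] (σ : Type) [Fintype σ] (d q τ : ℕ)
      (V : Submodule K (MvPolynomial σ K)), q < d → (∀ v ∈ V, v.IsHomogeneous d) →
      (Fintype.card σ + (d - q) - 1).choose (d - q) ≤ Module.finrank K V →
      (Fintype.card σ + (d - q + τ) - 1).choose (d - q + τ) ≤
        Module.finrank K (Submodule.span K {p : MvPolynomial σ K | ∃ (β : σ →₀ ℕ)
          (v : MvPolynomial σ K), β.degree = τ ∧ v ∈ V ∧ p = monomial β 1 * v})) (K : Type) [Field K] {m n : ℕ} (hm : 10 ≤ m)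
    (hn : 2 * m ^ 2 + 2 * m < n) [NeZero n] (k τ : ℕ) (hk : 3 * m ≤ 2 * k)
    (hkn : k + 2 * m ≤ n + 1) :
    shiftedPartialsRank K k τ (paddedPerPoly K m n) <
      shiftedPartialsRank K k τ (Literature.Computability.AlgebraicComplexity.detPoly (Fin n) K) :=
  (shiftedPartialsRank_paddedPerPoly_lt_choose (K := K) (by omega) (by omega) k τ (by omega)).trans_le
    (choose_le_shiftedPartialsRank_detPoly hMac K (by omega) (by omega)
      (choose_sq_ge_choose hm hn hk hkn) τ)

end Literature.Barriers.ValiantsHypothesis
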